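import Mathlib

/-!
# LINE `valuative_door` (crux `WeakLifting`, stmt-ValiantsHypothesis-19561) — plan steps 6–7 (val-idea-24 g3
# `valuative_door-plan-rankone.md`): STRICT TOP-`m` SETS OF A FAMILY OF LINES ARE FEW (the rank potential)

HONEST FRAMING.  Helper lemmas (cell `pub-symmetroid`, seat val-sym-lift-p1 g21, 2026-08-29; `--supports 19561 --as helper`), companion
of `…KPlusLogSqLawValuativeDoorRankOneExpansion` (steps 1–5).  Pure combinatorics of `K` lines `s ↦ a l + s · d l` (`a l : ℝ`,
slopes `d l : ℕ`): a finite set `T` of indices is a STRICT TOP SET at the parameter `s` if every line of `T` lies strictly above every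
line outside `T` at `s`.  Along `s` the strict top sets can only exchange small slopes for large ones, so the RANK POTENTIAL
`Φ(T) = Σ_{l ∈ T} #{l' : d l' < d l}` is injective on the realisable strict top sets of a fixed cardinality `m`; with the crude range
`Φ ≤ m · (K − 1)` this bounds their number by `m · (K − 1) + 1` (`card_topSets_le`), and — when the slopes are pairwise distinct, which
dissociation forces — `Φ` is a sum of `m` DISTINCT ranks, so it ranges over an interval of length `m (K − m)`: the pen's SHARP
`m · (K − m) + 1` (`card_topSets_le_sharp`).  By `dominant_iff_log` / `exists_dominant_iff_exists_slope` of the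
companion file, dominant exponents of a dissociated rank-one pencil with unit minors are strict top-`m` sets of the lines
`log v (ε l) + s · d l`, which is how the line's calibration target `ValRankOneSharpModularDiss` consumes this file.  Nothing here is a
stub of the line, closes anything, or bears on `WeakLifting` / `TropicalB`, `MatrixDescartes` (18050) or VP ≠ VNP.
[elementary; no citation]
-/

set_option linter.dupNamespace false
set_option autoImplicit false

namespace Summit.ValiantsHypothesis.ValiantsHypothesis.Theorems.KPlusLogSqLaw.ValDoor

open Finset
open scoped BigOperators

variable {K : ℕ}

/-- `T` is a STRICT TOP SET of the lines `l ↦ a l + s · d l` at the parameter `s`: every line in `T` is strictly above every line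
outside `T` at `s`. [definition-free predicate, spelled out in every statement below] -/
theorem crossing_slope_lt {a : Fin K → ℝ} {d : Fin K → ℕ} {s s' : ℝ} {l l' : Fin K}
    (h1 : a l' + s * d l' < a l + s * d l) (h2 : a l + s' * d l < a l' + s' * d l') (hss : s < s') : d l < d l' := by
  by_contra hle
  push Not at hle
  have hle' : (d l' : ℝ) ≤ d l := by exact_mod_cast hle
  nlinarith

/-- the rank of a letter by slope: number of letters of strictly smaller slope. -/
theorem rank_lt_rank_of_lt (d : Fin K → ℕ) {l l' : Fin K} (h : d l < d l') :
    (univ.filter fun x => d x < d l).card < (univ.filter fun x => d x < d l').card := by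
  refine Finset.card_lt_card ⟨fun x hx => ?_, ?_⟩
  · rw [mem_filter] at hx ⊢
    exact ⟨hx.1, hx.2.trans h⟩
  · intro hsub
    have : l ∈ univ.filter fun x => d x < d l := hsub (by rw [mem_filter]; exact ⟨mem_univ _, h⟩)
    rw [mem_filter] at this
    exact lt_irrefl _ this.2

/-- the rank is at most `K − 1` (the letter itself is not counted). -/
theorem rank_le (d : Fin K → ℕ) (l : Fin K) : (univ.filter fun x => d x < d l).card ≤ K - 1 := by
  have h : (univ.filter fun x => d x < d l) ⊆ univ.erase l := by
    intro x hx
    rw [mem_filter] at hx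
    rw [mem_erase]
    exact ⟨fun hxl => by rw [hxl] at hx; exact lt_irrefl _ hx.2, mem_univ _⟩
  refine (card_le_card h).trans ?_
  rw [card_erase_of_mem (mem_univ _), card_univ, Fintype.card_fin]

/-- **Exchange direction.**  If `T` is a strict top set at `s` and `T'` a strict top set at `s' > s`, then every letter of `T \\ T'`
(leaving) has strictly smaller slope than every letter of `T' \\ T` (entering). [elementary] -/
theorem slope_lt_of_topSets {a : Fin K → ℝ} {d : Fin K → ℕ} {s s' : ℝ} {T T' : Finset (Fin K)}
    (hT : ∀ l ∈ T, ∀ l' ∉ T, a l' + s * d l' < a l + s * d l)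
    (hT' : ∀ l ∈ T', ∀ l' ∉ T', a l' + s' * d l' < a l + s' * d l) (hss : s < s')
    {x y : Fin K} (hx : x ∈ T \ T') (hy : y ∈ T' \ T) : d x < d y := by
  rw [mem_sdiff] at hx hy
  exact crossing_slope_lt (hT x hx.1 y hy.2) (hT' y hy.1 x hx.2) hss

/-- **The rank potential strictly increases** from a strict top set at `s` to a DIFFERENT strict top set of the same cardinality at
`s' > s`. [elementary: equal-size exchange of small slopes for large slopes] -/
theorem rankPotential_lt_of_topSets {a : Fin K → ℝ} {d : Fin K → ℕ} {s s' : ℝ} {T T' : Finset (Fin K)}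
    (hT : ∀ l ∈ T, ∀ l' ∉ T, a l' + s * d l' < a l + s * d l)
    (hT' : ∀ l ∈ T', ∀ l' ∉ T', a l' + s' * d l' < a l + s' * d l) (hss : s < s')
    (hcard : T.card = T'.card) (hne : T ≠ T') :
    ∑ l ∈ T, (univ.filter fun x => d x < d l).card < ∑ l ∈ T', (univ.filter fun x => d x < d l).card := by
  set rk : Fin K → ℕ := fun l => (univ.filter fun x => d x < d l).card with hrk
  -- split both sums along the common part
  have hsplit : ∀ A B : Finset (Fin K), ∑ l ∈ A, rk l = ∑ l ∈ A ∩ B, rk l + ∑ l ∈ A \ B, rk l := by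
    intro A B
    rw [← Finset.sum_inter_add_sum_sdiff A B rk]
  rw [hsplit T T', hsplit T' T, Finset.inter_comm T' T]
  apply Nat.add_lt_add_left
  -- the two difference sets have the same (positive) cardinality
  have hcd : (T \ T').card = (T' \ T).card := by
    have h1 := Finset.card_sdiff_add_card_inter T T'
    have h2 := Finset.card_sdiff_add_card_inter T' T
    rw [Finset.inter_comm T' T] at h2
    omega
  have hpos : 0 < (T \ T').card := by
    rw [Finset.card_pos]
    by_contra hem
    rw [Finset.not_nonempty_iff_eq_empty] at hem
    have hsub : T ⊆ T' := Finset.sdiff_eq_empty_iff_subset.1 hem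
    exact hne (Finset.eq_of_subset_of_card_le hsub (by omega))
  -- pick a maximal-rank leaving letter and a minimal-rank entering letter
  obtain ⟨x, hx, hxmax⟩ := Finset.exists_max_image (T \ T') rk (Finset.card_pos.1 hpos)
  have hpos' : 0 < (T' \ T).card := by rw [← hcd]; exact hpos
  obtain ⟨y, hy, hymin⟩ := Finset.exists_min_image (T' \ T) rk (Finset.card_pos.1 hpos')
  have hxy : rk x < rk y := rank_lt_rank_of_lt d (slope_lt_of_topSets hT hT' hss hx hy)
  calc ∑ l ∈ T \ T', rk l ≤ (T \ T').card • rk x := Finset.sum_le_card_nsmul _ _ _ fun l hl => hxmax l hl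
    _ = (T \ T').card * rk x := by rw [smul_eq_mul]
    _ < (T' \ T).card * rk y := by
        rw [hcd]; exact Nat.mul_lt_mul_of_pos_left hxy hpos'
    _ = (T' \ T).card • rk y := by rw [smul_eq_mul]
    _ ≤ ∑ l ∈ T' \ T, rk l := Finset.card_nsmul_le_sum _ _ _ fun l hl => hymin l hl

/-- **FEW STRICT TOP SETS (rank-potential bound).**  For any family of realisable strict top sets of common cardinality `m` — a finset
`𝒯` of sets each of which is a strict top set of the lines `a l + s · d l` at some parameter — `#𝒯 ≤ m · (K − 1) + 1`.
(Sharp form `m · (K − m) + 1` for distinct slopes: `card_topSets_le_sharp` below.) [elementary] -/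
theorem card_topSets_le (a : Fin K → ℝ) (d : Fin K → ℕ) (m : ℕ) (𝒯 : Finset (Finset (Fin K)))
    (hcard : ∀ T ∈ 𝒯, T.card = m)
    (htop : ∀ T ∈ 𝒯, ∃ s : ℝ, ∀ l ∈ T, ∀ l' ∉ T, a l' + s * d l' < a l + s * d l) :
    𝒯.card ≤ m * (K - 1) + 1 := by
  set Φ : Finset (Fin K) → ℕ := fun T => ∑ l ∈ T, (univ.filter fun x => d x < d l).card with hΦ
  -- Φ is injective on 𝒯
  have hinj : Set.InjOn Φ (𝒯 : Set (Finset (Fin K))) := by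
    intro T hT T' hT' hΦeq
    by_contra hne
    obtain ⟨s, hs⟩ := htop T hT
    obtain ⟨s', hs'⟩ := htop T' hT'
    have hc : T.card = T'.card := by rw [hcard T hT, hcard T' hT']
    rcases lt_trichotomy s s' with hlt | heq | hgt
    · exact absurd hΦeq (ne_of_lt (rankPotential_lt_of_topSets hs hs' hlt hc hne))
    · -- same parameter: two different strict top sets of equal size is impossible
      subst heq
      apply hne
      have key : ∀ {A B : Finset (Fin K)}, A.card = B.card →
          (∀ l ∈ A, ∀ l' ∉ A, a l' + s * d l' < a l + s * d l) →
          (∀ l ∈ B, ∀ l' ∉ B, a l' + s * d l' < a l + s * d l) → A ⊆ B := by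
        intro A B hAB hA hB x hxA
        by_contra hxB
        -- A \ B nonempty (x) so B \ A nonempty too
        have h1 := Finset.card_sdiff_add_card_inter A B
        have h2 := Finset.card_sdiff_add_card_inter B A
        rw [Finset.inter_comm B A] at h2
        have hxmem : x ∈ A \ B := Finset.mem_sdiff.2 ⟨hxA, hxB⟩
        have hposA : 0 < (A \ B).card := Finset.card_pos.2 ⟨x, hxmem⟩
        have hposB : 0 < (B \ A).card := by omega
        obtain ⟨y, hy⟩ := Finset.card_pos.1 hposB
        rw [Finset.mem_sdiff] at hy
        have e1 := hA x hxA y hy.2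
        have e2 := hB y hy.1 x hxB
        linarith
      exact Finset.Subset.antisymm (key hc hs hs') (key hc.symm hs' hs)
    · exact absurd hΦeq.symm (ne_of_lt (rankPotential_lt_of_topSets hs' hs hgt hc.symm (Ne.symm hne)))
  -- Φ maps 𝒯 into `range (m * (K - 1) + 1)`
  have hrange : ∀ T ∈ 𝒯, Φ T ∈ Finset.range (m * (K - 1) + 1) := by
    intro T hT
    rw [Finset.mem_range, Nat.lt_succ_iff, hΦ]
    calc ∑ l ∈ T, (univ.filter fun x => d x < d l).card ≤ ∑ _l ∈ T, (K - 1) :=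
          Finset.sum_le_sum fun l _ => rank_le d l
      _ = m * (K - 1) := by rw [Finset.sum_const, smul_eq_mul, hcard T hT]
  calc 𝒯.card ≤ (Finset.range (m * (K - 1) + 1)).card := Finset.card_le_card_of_injOn Φ hrange hinj
    _ = m * (K - 1) + 1 := Finset.card_range _

/-- a set of `n` naturals has sum at least `0 + 1 + ⋯ + (n − 1)`. [bookkeeping] -/
theorem sum_range_le_sum_of_card : ∀ (n : ℕ) (S : Finset ℕ), S.card = n → ∑ i ∈ range n, i ≤ ∑ x ∈ S, x := by
  intro n
  induction n with
  | zero => intro S _; simp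
  | succ n ih =>
    intro S hS
    have hne : S.Nonempty := by rw [← Finset.card_pos, hS]; exact Nat.succ_pos n
    have hMmem : S.max' hne ∈ S := Finset.max'_mem S hne
    have hcard' : (S.erase (S.max' hne)).card = n := by rw [Finset.card_erase_of_mem hMmem, hS]; rfl
    have hsub : S ⊆ range (S.max' hne + 1) := fun x hx => Finset.mem_range.2 (Nat.lt_succ_of_le (S.le_max' x hx))
    have hMge : n + 1 ≤ S.max' hne + 1 := by
      have h := Finset.card_le_card hsub
      rw [Finset.card_range, hS] at h
      exact h
    rw [Finset.sum_range_succ, ← Finset.add_sum_erase S (fun x => x) hMmem]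
    have hih := ih (S.erase (S.max' hne)) hcard'
    omega

/-- the rank by slope is injective when the slopes are. [bookkeeping] -/
theorem rank_injective {K : ℕ} (d : Fin K → ℕ) (hd : Function.Injective d) :
    Function.Injective fun l => (univ.filter fun x => d x < d l).card := by
  intro l l' h
  by_contra hne
  rcases lt_trichotomy (d l) (d l') with hlt | heq | hgt
  · exact absurd h (ne_of_lt (rank_lt_rank_of_lt d hlt))
  · exact hne (hd heq)
  · exact absurd h.symm (ne_of_lt (rank_lt_rank_of_lt d hgt))

/-- at one parameter there is at most one strict top set of each cardinality. [elementary] -/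
theorem topSet_subset_of_card_eq {K : ℕ} {a : Fin K → ℝ} {d : Fin K → ℕ} {s : ℝ} {A B : Finset (Fin K)} (hAB : A.card = B.card)
    (hA : ∀ l ∈ A, ∀ l' ∉ A, a l' + s * d l' < a l + s * d l) (hB : ∀ l ∈ B, ∀ l' ∉ B, a l' + s * d l' < a l + s * d l) :
    A ⊆ B := by
  intro x hxA
  by_contra hxB
  have h1 := Finset.card_sdiff_add_card_inter A B
  have h2 := Finset.card_sdiff_add_card_inter B A
  rw [Finset.inter_comm B A] at h2
  have hposA : 0 < (A \ B).card := Finset.card_pos.2 ⟨x, Finset.mem_sdiff.2 ⟨hxA, hxB⟩⟩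
  have hposB : 0 < (B \ A).card := by omega
  obtain ⟨y, hy⟩ := Finset.card_pos.1 hposB
  rw [Finset.mem_sdiff] at hy
  have e1 := hA x hxA y hy.2
  have e2 := hB y hy.1 x hxB
  linarith

/-- **FEW STRICT TOP SETS — SHARP (the pen's `m · (K − m) + 1`).**  With pairwise distinct slopes, a family of realisable strict
top sets of common cardinality `m` of `K` lines has at most `m · (K − m) + 1` members: the rank potential `Φ(T) = Σ_{l ∈ T} rank l` is
injective on it (`rankPotential_lt_of_topSets`) and, being a sum of `m` DISTINCT ranks in `[0, K − 1]`, takes values in an interval of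
length `m (K − m)`. [elementary] -/
theorem card_topSets_le_sharp {K : ℕ} (a : Fin K → ℝ) (d : Fin K → ℕ) (hd : Function.Injective d) (m : ℕ)
    (𝒯 : Finset (Finset (Fin K))) (hcard : ∀ T ∈ 𝒯, T.card = m)
    (htop : ∀ T ∈ 𝒯, ∃ s : ℝ, ∀ l ∈ T, ∀ l' ∉ T, a l' + s * d l' < a l + s * d l) :
    𝒯.card ≤ m * (K - m) + 1 := by
  set rk : Fin K → ℕ := fun l => (univ.filter fun x => d x < d l).card with hrk
  set Φ : Finset (Fin K) → ℕ := fun T => ∑ l ∈ T, rk l with hΦ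
  have hrk_inj : Function.Injective rk := rank_injective d hd
  -- Φ is injective on 𝒯
  have hinj : Set.InjOn Φ (𝒯 : Set (Finset (Fin K))) := by
    intro T hT T' hT' hΦeq
    by_contra hne
    obtain ⟨s, hs⟩ := htop T hT
    obtain ⟨s', hs'⟩ := htop T' hT'
    have hc : T.card = T'.card := by rw [hcard T hT, hcard T' hT']
    rcases lt_trichotomy s s' with hlt | heq | hgt
    · exact absurd hΦeq (ne_of_lt (rankPotential_lt_of_topSets hs hs' hlt hc hne))
    · subst heq
      exact hne (Finset.Subset.antisymm (topSet_subset_of_card_eq hc hs hs') (topSet_subset_of_card_eq hc.symm hs' hs))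
    · exact absurd hΦeq.symm (ne_of_lt (rankPotential_lt_of_topSets hs' hs hgt hc.symm (Ne.symm hne)))
  set L : ℕ := ∑ i ∈ range m, i with hL
  -- lower bound: a sum of m distinct naturals
  have hlow : ∀ T ∈ 𝒯, L ≤ Φ T := by
    intro T hT
    have h1 : (T.image rk).card = m := by rw [Finset.card_image_of_injective _ hrk_inj, hcard T hT]
    have h2 := sum_range_le_sum_of_card m (T.image rk) h1
    rw [Finset.sum_image fun x _ y _ h => hrk_inj h] at h2
    exact h2
  -- upper bound: the co-ranks `K − 1 − rk` are distinct too
  have hupp : ∀ T ∈ 𝒯, Φ T + L ≤ m * (K - 1) := by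
    intro T hT
    set crk : Fin K → ℕ := fun l => (K - 1) - rk l with hcrk
    have hcrk_inj : Function.Injective crk := by
      intro l l' h
      have h1 := rank_le d l
      have h2 := rank_le d l'
      apply hrk_inj
      change (K - 1) - rk l = (K - 1) - rk l' at h
      change rk l ≤ K - 1 at h1
      change rk l' ≤ K - 1 at h2
      omega
    have h1 : (T.image crk).card = m := by rw [Finset.card_image_of_injective _ hcrk_inj, hcard T hT]
    have h2 := sum_range_le_sum_of_card m (T.image crk) h1
    rw [Finset.sum_image fun x _ y _ h => hcrk_inj h] at h2
    have h3 : ∑ l ∈ T, crk l + Φ T = m * (K - 1) := by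
      change ∑ l ∈ T, crk l + ∑ l ∈ T, rk l = m * (K - 1)
      rw [← Finset.sum_add_distrib, Finset.sum_congr rfl fun l _ => (Nat.sub_add_cancel (rank_le d l) : crk l + rk l = K - 1),
        Finset.sum_const, smul_eq_mul, hcard T hT]
    omega
  have hrange : ∀ T ∈ 𝒯, Φ T ∈ Finset.Icc L (m * (K - 1) - L) := by
    intro T hT
    rw [Finset.mem_Icc]
    have h1 := hlow T hT
    have h2 := hupp T hT
    omega
  have hL2 : L * 2 = m * (m - 1) := Finset.sum_range_id_mul_two m
  have hfin : m * (K - 1) - L + 1 - L ≤ m * (K - m) + 1 := by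
    rcases Nat.eq_zero_or_pos m with hm0 | hmpos
    · subst hm0; simp [hL]
    · by_cases hKm : m ≤ K
      · have hsplit : K - 1 = (K - m) + (m - 1) := by omega
        have hP : m * (K - 1) = m * (K - m) + m * (m - 1) := by rw [hsplit, mul_add]
        omega
      · push Not at hKm
        have h0 : K - m = 0 := by omega
        have hle : m * (K - 1) ≤ m * (m - 1) := Nat.mul_le_mul_left m (by omega)
        rw [h0, mul_zero]
        omega
  calc 𝒯.card ≤ (Finset.Icc L (m * (K - 1) - L)).card := Finset.card_le_card_of_injOn Φ hrange hinj
    _ = m * (K - 1) - L + 1 - L := Nat.card_Icc _ _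
    _ ≤ m * (K - m) + 1 := hfin

end Summit.ValiantsHypothesis.ValiantsHypothesis.Theorems.KPlusLogSqLaw.ValDoor
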